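import Summits.BirchSwinnertonDyer.Rank1Residual.X11b.VisibilityRankOne
import Summits.BirchSwinnertonDyer.BirchSwinnertonDyer.Theorems.Rank1ResidualIntModelReduction
import Literature.NumberTheory.EllipticCurves.CongruentNumberCurveSupersingular
import HarnessLib

/-!
# BSD rank-≤1 residual cell, class X11b (and every surjective rank-one pair with `p² ‖ #Ш_an`): the
# rank-one VISIBILITY lever `bsdp_of_kolyvagin_of_congr` with the exceptional set `S` given by a
# LIST OF RATIONAL PRIMES and the good reduction outside `S` read off integer models

HONEST FRAMING (cell `b2b-bsdres-*`, run/shared/lean/b2b/bsd-rank1-residual/, verbatim): the goal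
of the cell is to DELETE the COMBINATION-SHAPED residual classes for ALL analytic-rank `≤ 1` elliptic
curves over `ℚ` — "full BSD formula for every rank `≤ 1` curve in class C" assembled STRICTLY from
published theorems — so that the rank-`≤ 1` remainder becomes exactly the CONSTRUCTION-SHAPED
classes, which are TYPED (missing-input Props), NOT attempted; this is not "finishing BSD".
Prove what is provable now; shrink each hard class to its core with data; no claim beyond stated
classes. Unit `b2b-bsdres-x11c` (gen 6). Theorems only (no definition, no named fact); a certificate
SHAPE, not a class theorem; the lane certifies pairs and owns verdicts; no label changes.

## What this file does

`X11b/VisibilityRankOne.lean` (`bsdp_of_kolyvagin_of_congr`, p202892) takes the exceptional set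
`S : Finset (HeightOneSpectrum (𝓞 ℚ))` with "outside `S`: good reduction of `W`, `W'` and `v ∤ p`"
and "`W'(ℚ_v)[p] = 0` for `v ∈ S`". In every per-pair certificate `S` is the set of places over the
prime divisors of `p·N_E·N_{E'}` and the first clause is a DISCRIMINANT FACTORISATION of the two
integer models (an integral equation with `v`-unit discriminant has good reduction, Silverman AEC
VII.5.1(a); tree `hasGoodReductionAt_map_of_not_dvd`). This file performs that bookkeeping once:

* `mem_of_prime_dvd_prod_pow`, `forall_mem_of_natAbs_eq_prod_pow` — from a factorisation certificate
  `|Δ| = ∏ qᵢ^{eᵢ}` over a list of primes (a `decide`-able equality of naturals), every prime divisor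
  of `Δ` is in the list;
* `bsdp_of_kolyvagin_of_congr_of_primeList` — `bsdp_of_kolyvagin_of_congr` for `W = E₀ ⊗ ℚ`,
  `W' = F₀ ⊗ ℚ` with `Δ(E₀)`, `Δ(F₀)` supported on a list `L ∋ p` of primes, the local condition
  `W'(ℚ_v)[p] = 0` being asked exactly at the places `v` with `primesEquiv v ∈ L` (the finite set
  `S` is built inside the proof; its membership is `primesEquiv v ∈ L`).

Consumers: the per-pair files `Rank1Residual/Visibility/RankOnePairs*.lean` (unit x11c gen 6: the 30
open `(class, 3)` survivors of the hypothesis census HOME/b2b-bsdres-hyp/hyp/vis/VISIBILITY-FILTER.md §5,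
classes X11b / X4 / X7 / X8) and `X11b/VisibilityPair403280bd1.lean` (gen 4, written before this
wrapper). References: Cremona–Mazur 2000 §3 [CremonaMazur2000]; Agashe–Stein 2002 Thm. 3.1
[AgasheStein2002]; Silverman AEC VII.5.1(a) [SilvermanAEC2009].
-/

noncomputable section

open scoped Classical

open WeierstrassCurve Literature.NumberTheory.EllipticCurves
  Literature.NumberTheory.EllipticCurves.Rank1Residual
  Literature.NumberTheory.EllipticCurves.Rank1Residual.Typed
open NumberField IsDedekindDomain

namespace Summit.BirchSwinnertonDyer.Rank1Residual.X11b

/-- A prime dividing `∏ qᵢ ^ eᵢ` (over a list of primes `qᵢ`) is one of the `qᵢ`. [folklore] -/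
theorem mem_of_prime_dvd_prod_pow (L es : List ℕ) (hL : ∀ q ∈ L, q.Prime) {q : ℕ} (hq : q.Prime)
    (h : q ∣ ((L.zip es).map fun qe : ℕ × ℕ ↦ qe.1 ^ qe.2).prod) : q ∈ L := by
  obtain ⟨a, ha, hqa⟩ := (Prime.dvd_prod_iff hq.prime).mp h
  obtain ⟨qe, hqe, rfl⟩ := List.mem_map.mp ha
  have h1 : qe.1 ∈ L := (List.of_mem_zip hqe).1
  have h2 : q ∣ qe.1 := hq.dvd_of_dvd_pow hqa
  rwa [(Nat.prime_dvd_prime_iff_eq hq (hL _ h1)).mp h2]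

/-- From a factorisation certificate `|n| = ∏ qᵢ ^ eᵢ` over a list of primes: every prime divisor of
`n` is in the list. [folklore] -/
theorem forall_mem_of_natAbs_eq_prod_pow {n : ℤ} (L es : List ℕ) (hL : ∀ q ∈ L, q.Prime)
    (h : n.natAbs = ((L.zip es).map fun qe : ℕ × ℕ ↦ qe.1 ^ qe.2).prod) :
    ∀ q : ℕ, q.Prime → (q : ℤ) ∣ n → q ∈ L := by
  intro q hq hd
  exact mem_of_prime_dvd_prod_pow L es hL hq (h ▸ Int.natCast_dvd.mp hd)

/-- **The rank-one visibility lever with `S` = the places over a list of rational primes.**  As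
`bsdp_of_kolyvagin_of_congr`, for `W = E₀ ⊗ ℚ`, `W' = F₀ ⊗ ℚ` integer models whose discriminants
are supported on a list of primes `L ∋ p`: outside the places over `L` both have good reduction
(Silverman AEC VII.5.1(a)) and the place does not divide `p`, so the local condition is only asked at
the places over `L`. [cite: SilvermanAEC2009, VII.5 Prop. 5.1(a)] [cite: CremonaMazur2000, §3 and Table 1] -/
theorem bsdp_of_kolyvagin_of_congr_of_primeList (W : WeierstrassCurve ℚ) [W.IsElliptic] (p : ℕ)
    [Fact p.Prime] (hCT : exists_casselsTate_pairing (K := ℚ))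
    (hGZK : rank_eq_analyticRank_of_analyticRank_le_one)
    {N : ℕ} [NeZero N] {K : Type} [Field K] [NumberField K] (hKo : kolyvagin N W K)
    (hB : Kolyvagin1990_padicValNat_card_sha_le N W K) (hK : IsImaginaryQuadratic K)
    (hH : SatisfiesHeegnerHypothesis N K) {P : (W.baseChange K).toAffine.Point}
    (hP : IsHeegnerPoint N W K P) (hnt : ¬ IsOfFinAddOrder P)
    (hp2 : p ≠ 2) (hρ : W.HasSurjectiveModNGaloisRep p)
    (hI : padicValNat p (AddSubgroup.zmultiples P).index ≤ 1)
    (hr : W.analyticRank = 1) {s : ℚ} (hs : shaAn W = (s : ℂ)) (hv : padicValRat p s = 2)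
    (W' : WeierstrassCurve ℚ) [W'.IsElliptic]
    (θ : geomTorsion W' (p : ℤ) ≃+ geomTorsion W (p : ℤ))
    (hθ : ∀ (σ : Field.absoluteGaloisGroup ℚ) (P : geomTorsion W' (p : ℤ)), θ (σ • P) = σ • θ P)
    (hrank : 3 ≤ W'.mordellWeilRank)
    {E₀ F₀ : WeierstrassCurve ℤ} (hE : E₀.map (Int.castRingHom ℚ) = W)
    (hF : F₀.map (Int.castRingHom ℚ) = W') (L : List ℕ) (hpL : p ∈ L)
    (hΔE : ∀ q : ℕ, q.Prime → (q : ℤ) ∣ E₀.Δ → q ∈ L)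
    (hΔF : ∀ q : ℕ, q.Prime → (q : ℤ) ∣ F₀.Δ → q ∈ L)
    (hloc : ∀ v : HeightOneSpectrum (𝓞 ℚ), (Rat.HeightOneSpectrum.primesEquiv v : ℕ) ∈ L →
      Nat.card (nsmulAddMonoidHom p :
        (W'.baseChange (v.adicCompletion ℚ)).toAffine.Point →+ _).ker = 1) :
    BSDp W p := by
  have hp : p.Prime := Fact.out
  set e := Rat.HeightOneSpectrum.primesEquiv (R := 𝓞 ℚ) with he
  -- the finite set of places over `L`
  set S : Finset (HeightOneSpectrum (𝓞 ℚ)) :=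
    (L.filterMap fun q ↦ if h : q.Prime then some (e.symm ⟨q, h⟩) else none).toFinset with hSdef
  have hmemS : ∀ v : HeightOneSpectrum (𝓞 ℚ), v ∈ S ↔ (e v : ℕ) ∈ L := by
    intro v
    rw [hSdef, List.mem_toFinset, List.mem_filterMap]
    constructor
    · rintro ⟨q, hq, hqv⟩
      by_cases hqp : q.Prime
      · rw [dif_pos hqp, Option.some.injEq] at hqv
        rw [← hqv, Equiv.apply_symm_apply]
        exact hq
      · rw [dif_neg hqp] at hqv
        exact absurd hqv (by simp)
    · intro hv
      refine ⟨(e v : ℕ), hv, ?_⟩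
      rw [dif_pos (e v).2]
      simp
  refine bsdp_of_kolyvagin_of_congr W p hCT hGZK hKo hB hK hH hP hnt hp2 hρ hI hr hs hv W' θ hθ hrank S
    (fun v hvS ↦ ?_) (fun v hvS ↦ hloc v ((hmemS v).mp hvS))
  have hvL : (e v : ℕ) ∉ L := fun h ↦ hvS ((hmemS v).mpr h)
  have hq : (e v : ℕ).Prime := (e v).2
  refine ⟨?_, ?_, fun hpv ↦ hvL ?_⟩
  · rw [← hE]
    exact hasGoodReductionAt_map_of_not_dvd E₀ v fun h ↦ hvL (hΔE _ hq h)
  · rw [← hF]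
    exact hasGoodReductionAt_map_of_not_dvd F₀ v fun h ↦ hvL (hΔF _ hq h)
  · rw [he, Rat.HeightOneSpectrum.primesEquiv_eq_of_natCast_mem v hp hpv]
    exact hpL

end Summit.BirchSwinnertonDyer.Rank1Residual.X11b

end
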